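import Summits.BirchSwinnertonDyer.BirchSwinnertonDyer.Theorems.ByReductionTypeAtTwoAdditiveKatoTransportDefs
import HarnessLib

/-!
# Route ByReductionTypeAtTwo, crux `AdditiveRankZeroAtTwo` (stmt-BirchSwinnertonDyer-19098), child C4″
# `AdditivePotMultOverKAtTwo` (stmt-BirchSwinnertonDyer-22618) NARROWED: the `E[2]`-REDUCIBLE additive curves WITH a split
# multiplicative twist by `−1` or `−2` at `2` — the last habitat of the over-`K` object (v9's binder `hQKm9`) — re-keyed in
# the lane's Kato currency: Kato's MEMBER package (Thm. 12.4–12.6, 13.13, §14.14–Prop. 14.16 at `T = V_{ℤ₂}(f)(1)`, readings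
# R1–R13 + R12♯) with its ONE twist-sensitive step R8 (= the local term of Thm. 12.5 (3) at the exceptional prime of
# (12.5.1)) run through the TRANSPORT road T20 of `…AdditiveKatoTransportDefs.lean` (Greenberg LNM 1716 Thm. 1.14,
# Mazur–Tate–Teitelbaum §I.17, kernel `Kato2004/ExceptionalPrimeInvolutionTransportProofs.lean`); TWO typed block
# targets (member-SHARP bound) and the IMAGE-FREE spelling of T20's one object-level input (MEMO tier, nothing asserted)

Seat `bsd-2adic-k4-w3` GEN 0 (2026-08-29; explicit unit of director-bsd g16 (309)(7): «C4″ 22618 narrowed — split-twist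
reducible + irreducible Kato 12.10 upper half at 2»). Pattern of `…AdditiveKatoExceptionalPrimeDefs.lean` (addL2x GEN 15)
and `…AdditiveKatoTransportDefs.lean` (addL2x GEN 16, whose §1–§3 treat the IRREDUCIBLE `E[2]` split-twist blocks and
say «nothing for reducible `E[2]`»); pen ruling RC-307 (β): statements at `p = 2` beyond the printed range are
Summits-side `@[conjecture]` constants consumed BY NAME. HONEST FRAMING (cell `bsd-2adic`, HUMAN RULING D-0036/D-0054):
THREE typed constants (nothing asserted) and pure-logic lemmas; types-the-object-of; closes none; nothing booked; BSD is
not proved by any of this. PARTITION: X5@2 additive potentially-multiplicative sub-block, `E[2]` REDUCIBLE with a split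
multiplicative twist by `−1` or `−2` at `2` (census `addL2x/gen13/POTMULT-NST-CENSUS`: 50 of the 463 classes, sub-block
`splitBAD-red`; all with `#E(ℚ)_tors = 2`, `#Ш_an = 16` on 45 and `64` on 5; `d* = −1` on 41, `d* = −2` on 9) × `p = 2`.

## R14 — why the member bound is SHARP on the reducible split-twist block too (numbering continues R1–R13 of
## `Kato2004/MemberHullInputsTwoNoSplitTwist.lean` and R12♯ of `Kato2004/MemberHullInputsTwoSharp.lean`; uses T20 (a)–(f)
## of `…AdditiveKatoTransportDefs.lean`)

Setting: `W/ℚ` globally minimal, non-CM, ADDITIVE at `2`, `W^{(d)}` SPLIT multiplicative at `2` for `d = −1` (resp.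
`d = −2`), `W[2]` REDUCIBLE (a rational `2`-isogeny; on the census always a rational point of order `2`), `L(W,1) ≠ 0`,
`Ш(W/ℚ)` finite; `W_K ∼ W` Kato's member (`T₂W_K ≅ V_{ℤ₂}(f)(1)`, §8.3); `Λ' = ℤ₂⟦T⟧`, `𝔮₀ = (T + 4/5)` (resp.
`(T + 6/5)`), `ι𝔮₀ = (T − 4)` (resp. `(T + 6)`).

* **R14 (a) (where the twist hypothesis enters).** R13 records that among R1–R12 the reduction/twist hypothesis at `2` is
  used ONLY in R8 = the field `divisibility_offP` of `Kato2004.MemberHullInputs` («`ℓ_𝔮(𝐇²) ≤ ℓ_𝔮(F/Λ z_γ⁰)` at every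
  height-one `𝔮 ≠ (2)`», Thm. 12.5 (3) on the `Δ`-trivial component), where (NST′) kills the local term `𝐇²_loc` by 13.13
  (T15/T16). On the present block that local term is `Λ'/𝔮₀` (length `1` at `𝔮₀`, `0` elsewhere; 13.13 + Silverman
  *ATAEC* V.5.3 / Ex. 5.11, T16–T18), so Kato's PRINTED Thm. 12.5 (3) gives `divisibility_offP` at every `𝔮 ∉ {(2), 𝔮₀}`
  and `ℓ_{𝔮₀}(𝐇²) ≤ ℓ_{𝔮₀}(F/Λz) + 1` — the member twin of the `+2`/`+1` of T17/T18 (kernel algebra of that defect: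
  `Kato2004.natCard_coinvariants_le_pow_mul_index_zeta_of_lengthAt_le_off_prime`, factor `2^{v₂(q_{𝔮₀}(0))} = 2²` resp.
  `2¹`). R12♯ (the sharp count `2t`) is reduction-type-free among additive curves (R13) and is untouched.
* **R14 (b) (the missing inequality is Conj. 12.10 at `𝔮₀`, and it is LATTICE-FREE).** For `ℚ`-isogenous lattices
  `T ⊂ T'` the maps `𝐇^i(T) → 𝐇^i(T')` have kernel and cokernel killed by a power of `2`, so `ℓ_𝔮(𝐇²(T)) = ℓ_𝔮(𝐇²(T'))`
  and `ℓ_𝔮(𝐇¹(T)/z) = ℓ_𝔮(𝐇¹(T')/z)` at every height-one `𝔮 ∌ 2`: Conj. 12.10's inequality `ℓ_{𝔮₀}(𝐇²) ≤ ℓ_{𝔮₀}(𝐇¹/z)`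
  at the member's lattice IS the same inequality at `T₂W`. No image hypothesis is involved (Thm. 12.4, 12.5 (1)–(3),
  12.6, 13.13, (17.13.1), 16.2/16.6 are image-free; only Thm. 12.5 (4) uses the image, and it is not used here).
* **R14 (c) (the transport supplies it, image-free).** T20 (a)–(e) derive Conj. 12.10's inequality at `𝔮₀` for `T₂W`
  from: (a) `char_{Λ'} X(W/ℚ_∞)` is `ι`-stable away from `(2)` — twist decomposition `X(W'/F_∞) ≐ X(W'/ℚ_∞) ⊕ X(W/ℚ_∞)`
  (`W' = W^{(d)}`, `F = ℚ(√d)`, `F_∞ = ℚ(ζ_{2^∞})`) UP TO MODULES KILLED BY `4`, plus Greenberg LNM 1716 Thm. 1.14 for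
  `W'` over `ℚ` and over `F` (PRINT; tree `Greenberg1999_thm114_charIdeal_iota_invariant`,
  `Greenberg1999.thm114_charIdeal_iota_invariant_splitMult_baseChange`). With `W[2]` REDUCIBLE the inflation–restriction
  and local-condition comparisons along the quadratic layer `F_∞/ℚ_∞` have kernels/cokernels killed by `#Δ = 2` (resp.
  by `4`) instead of being isomorphisms — which changes nothing AWAY FROM `(2)` (a `Λ'`-module killed by `2^k` has no
  length at a height-one `𝔮 ∌ 2`); so T20 (a) holds verbatim on this block. (b) the odd-branch §17.13 package of `W` —
  §1 below, GEN 16's constant with its (scope-only) irreducibility binder dropped; (c)(d)(e) KERNEL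
  (`Kato2004.lengthAt_X_le_of_skeleton_clean`, `…lengthAt_quotient_span_eq_comap_invol_of_invol_eq_unit_mul`,
  `…lengthAt_H2_le_of_transport_exceptional`) + PRINT (MTT §I.17). Hence `divisibility_offP` holds at `𝔮₀` as well, the
  structure `MemberHullInputs W_K 2 κ γ I 𝐲` is inhabited by Kato's genuine objects WITH the sharp count, and the tree's
  PROVED hull descent (`Kato2004.valuation_add_padicValNat_coinvariants_le_of_hull_smul`, as in
  `AddKatoTwo.katoMemberShaBound_two_sharp_NST`) gives the MEMBER-SHARP bound
  `ord₂ #Ш(W_K)[2^∞] + v₂ Tam(W_K) ≤ ord₂(L(W_K,1)/Ω(W_K)) + 2·ord₂ #W_K(ℚ)_tors` — the conclusion of §2's two constants.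
* **R14 (d) (what is PRINT on this block that is research-grade on the irreducible one).** Statement (A) at `(W_K, 2)`
  (`μ(𝐇²) = 0`, field `mu_H2`) is DISCHARGED for reducible `W[2]`: Lim 2017 Thm. 3.5 at `2` + Ferrero–Washington
  (`AddKatoTwo.conjA_two_of_not_irreducible`). So on this block the Kato half is {member readings R1–R13 + R12♯ (D-audited:
  hMHnst@2 PASS, hMH2♯ AS-PRINTED/EXACT), T20 (a) reading, §1's package, PRINT} — NO Conjecture-A input, NO target of the
  T19 kind beyond §1.
* **Status / WHAT IS NOT CLAIMED.** §2's constants are READING-GRADE MODULO §1 exactly as GEN 16's (−1)-block target is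
  (same transport, same one input); tag `@[conjecture]` per RC-307 (β) until the pen/audit-2 rule. The (−2)-block has the
  vocabulary gap of T20 (f) (the `χ_{−2}`-branch of the one-term measure has no tree name), so its object-level input is not
  typed here either. Not claimed: the statements themselves; anything for CM or analytic rank `1`; lower bounds; which curve
  `W_K` is; the equality form.

References: [Kato2004Asterisque] §8.3 (p. 181), Thm. 12.4 (p. 221), Thm. 12.5 (1)–(4) with (12.5.1) (pp. 221–222),
Thm. 12.6 and Rem. 12.7 (p. 222), Conj. 12.10 (p. 224), 13.9–13.10 (pp. 229–230), 13.13–13.14 (pp. 233–234), Thm. 14.5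
(p. 236), §14.8 (p. 238), 14.9 (p. 239), §14.14–Lemma 14.15 (pp. 243–244), Prop. 14.16 (2) and its proof (pp. 244–245),
§16.1, Thm. 16.2, 16.6 (pp. 268–271), §17.13 (pp. 279–280); [GreenbergLNM1716] Thm. 1.14 (p. 68), §2 (pp. 81–82), Prop.
4.13; [Greenberg1989] Thm. 2; [MazurTateTeitelbaum1986Invent] §I.10, §I.13, §I.17; [Kobayashi2006DocMath] Thm. 4.1;
[MazurRubin2004] Thm. 2.3.4; [SilvermanATAEC1994] Lemma V.5.2, Thm. V.5.3, Ex. 5.11; [Lim2017FineSelmer] Thm. 3.5;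
[FerreroWashington1979]; [CoatesSujatha2005] statement (A); [Cassels1965ArithmeticVIII]; tree
`Kato2004/MemberHullInputsTwo{,NoSplitTwist,Sharp,NoSplitTwistSharp}.lean`, `…AdditiveKatoTransportDefs.lean` (T20),
`…AdditiveKatoExceptionalPrimeDefs.lean` (T19). Census `run/shared/lean/pub/bsd-2adic/addL2x/gen13/POTMULT-NST-CENSUS-19098-addL2x-GEN13.tsv`.
-/

set_option autoImplicit false
-- the summit's namespace `Summit.BirchSwinnertonDyer.BirchSwinnertonDyer` (Sub = Summit) trips `dupNamespace`
set_option linter.dupNamespace false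

noncomputable section

open scoped Classical MatrixGroups ModularForm

open Field CongruenceSubgroup WeierstrassCurve Literature.NumberTheory.EllipticCurves
  Literature.NumberTheory.EllipticCurves.ModularForms

namespace Summit.BirchSwinnertonDyer.BirchSwinnertonDyer.Theorems.AddKatoTwo

/-! ## §1 The odd-branch Kato–Coleman package at `2`, IMAGE-FREE spelling (the one object-level input of R14/T20) -/

/-- [crux input, MEMO] **The ODD-BRANCH §17.13 package at `p = 2` for an additive curve whose twist by `−1` is split
multiplicative at `2`, WITHOUT a hypothesis on the image of `ρ̄₂`** — `KatoOddBranchInputsAtTwoNegOneSplitTwist`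
(`…AdditiveKatoTransportDefs.lean` §1, addL2x GEN 16) VERBATIM with its binder `W.HasIrreducibleModPGaloisRep 2` dropped
(that binder only restricted GEN 16's scope: every printed ingredient of T20 (b) — Kato Thm. 12.4, 12.5 (1)–(3), 12.6 for
`f_W`, (17.13.1) «exact upto ×2», 13.13, Thm. 16.2/16.6 for `f_{W^{(−1)}}` with `α = a₂ = 1`, the Coleman clause — is
image-free, exactly as the Literature facts `Kato2004.exists_multDivisibilityInputs_{nonsplit,split}` carry no image
hypothesis). For every globally minimal `W/ℚ` with `W^{(−1)}` SPLIT multiplicative at `2`, the cyclotomic `κ, γ` matching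
the cyclotomic variable, every newform `f` of `W^{(−1)}`, every pinned `I = 𝐇¹_Γ(T₂W)` and dual Selmer datum `D`: a
`Kato2004.MultDivisibilityInputs W 2 L κ γ I D` for `L = π·L⁻`, `π ∈ {5T+4, T−4}`, `L⁻ = padicLFunctionMinusBranchMult f 1 1`,
whose Coleman map has cokernel of length `0` at every height-one `𝔮 ∌ 2` and whose local term `H2loc` has length `0` at
every height-one `𝔮 ∌ 2` off `(π)`. This is the input under which §2's (−1)-block constant is reading-grade (R14 (c)); it
implies GEN 16's constant (`katoOddBranchInputsAtTwoNegOneSplitTwist_of_anyImage`). Conjecture-grade at `2` like the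
multiplicative lane's K11b (print at odd `p`: Kato §16 + Kobayashi 2006 Thm. 4.1). Nothing asserted.
[cite: Kato2004Asterisque, Thm. 12.4 (1) (p. 221), Thm. 12.5 (1)–(3) with (12.5.1) (pp. 221–222), Thm. 12.6 (p. 222), 13.13 (pp. 233–234), §16.1 and Thm. 16.2, 16.6 (pp. 268–271), §17.13 (pp. 279–280)]
[cite: Kobayashi2006DocMath, Thm. 4.1 (Coleman map of the Tate curve; odd p)] [cite: MazurTateTeitelbaum1986Invent, §I.10 and §I.13] -/
@[conjecture] def KatoOddBranchInputsAtTwoNegOneSplitTwistAnyImage : Prop :=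
  ∀ (W : WeierstrassCurve ℚ) [W.IsElliptic] [W.IsGloballyMinimal]
    [ContinuousSMul ℤ_[2] (W.tateModule 2)] {N : ℕ} [NeZero N] (f : CuspForm (Gamma0 N) 2)
    (κ : ZpExtension ℚ 2) (γ : absoluteGaloisGroup ℚ),
    (W.quadraticTwist (-1)).HasSplitMultiplicativeReductionAtPrime 2 →
    κ.IsCyclotomic → κ.IsTopGenerator γ → IsCyclotomicVariable 2 γ → IsNewformOf (W.quadraticTwist (-1)) f →
    ∀ (I : Kato2004.IwasawaH1Data W 2 κ γ) (D : W.SelmerDualData κ γ),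
      ∃ (π : IwasawaAlgebra 2),
        (π = PowerSeries.C (5 : ℤ_[2]) * PowerSeries.X + PowerSeries.C 4 ∨
          π = PowerSeries.X - PowerSeries.C 4) ∧
        ∃ K : Kato2004.MultDivisibilityInputs W 2
            (iwasawaToPowerSeries 2 π * padicLFunctionMinusBranchMult f (1 : ℚ_[2]) 1) κ γ I D,
          (∀ 𝔮 : PrimeSpectrum (IwasawaAlgebra 2), 𝔮.asIdeal.height = 1 →
              PowerSeries.C (2 : ℤ_[2]) ∉ 𝔮.asIdeal →
              Module.lengthAt (IwasawaAlgebra 2) (IwasawaAlgebra 2 ⧸ LinearMap.range K.col) 𝔮 = 0) ∧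
          (∀ 𝔮 : PrimeSpectrum (IwasawaAlgebra 2), 𝔮.asIdeal.height = 1 →
              PowerSeries.C (2 : ℤ_[2]) ∉ 𝔮.asIdeal → 𝔮.asIdeal ≠ Ideal.span {π} →
              Module.lengthAt (IwasawaAlgebra 2) K.H2loc 𝔮 = 0)

/-- **The image-free package implies GEN 16's** (`KatoOddBranchInputsAtTwoNegOneSplitTwist`: the same statement under the
extra binder «`W[2]` irreducible»). Pure logic; recorded so that ONE object-level input serves both the irreducible
(−1)-block target `KatoSharpAtTwoAdditiveNegOneSplitTwist` (T20) and the reducible one below (R14).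
[cite: Kato2004Asterisque, Thm. 12.6 (p. 222), §17.13 (pp. 279–280)] -/
theorem katoOddBranchInputsAtTwoNegOneSplitTwist_of_anyImage (h : KatoOddBranchInputsAtTwoNegOneSplitTwistAnyImage) :
    KatoOddBranchInputsAtTwoNegOneSplitTwist := by
  intro W _ _ _ N _ f κ γ hsp _hirr hκ hγ hcv hf I D
  exact h W f κ γ hsp hκ hγ hcv hf I D

/-! ## §2 The two block targets: the MEMBER-SHARP bound on the reducible (−1)- and (−2)-split-twist blocks -/

/-- [crux, MEMO] **The MEMBER-SHARP Kato-at-`2` bound on the additive (−1)-split-twist block with REDUCIBLE `E[2]`** (41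
X5@2 potentially multiplicative classes): for every globally minimal non-CM `W/ℚ` ADDITIVE at `2` whose twist by `−1` is
SPLIT multiplicative at `2`, `W[2]` REDUCIBLE, `L(W,1) ≠ 0`, `Ш(W/ℚ)` finite, there is a globally minimal `W_K ∼ W` with
`Ш(W_K)` finite and `L(W_K,1)/Ω(W_K) = q ∈ ℚ`,
`ord₂ #Ш(W_K)(2) + v₂(Tam(W_K)) ≤ ord₂ q + 2·ord₂ #W_K(ℚ)_tors` — the CONCLUSION of
`AddKatoTwo.katoMemberShaBound_two_sharp_NST` (the (NST′)-sharp member theorem, p674406) VERBATIM with its twist hypothesis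
replaced by «`W^{(−1)}` split». CONTENT = R14 (module docstring): Kato's member package (readings R1–R13 + R12♯) whose step
R8 is run, at the exceptional prime `𝔮₀ = (T + 4/5)` of (12.5.1), with Conj. 12.10's inequality — itself DERIVED by the
transport T20 (Greenberg LNM 1716 Thm. 1.14 over `ℚ` and over `ℚ(i)` for `W^{(−1)}`, PRINT; MTT §I.17, PRINT; kernel
`Kato2004/ExceptionalPrimeInvolutionTransportProofs.lean`) from §1's image-free odd-branch package — and statement (A) at
`(W_K,2)` from PRINT (Lim 3.5@2 + Ferrero–Washington, reducible `W[2]`). STATUS: reading-grade modulo §1 (tag kept per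
RC-307 (β)). Its consumer `AddKatoTwo.missingUpperBoundAt_two_of_katoMemberSharp_negOneSplitTwist` turns it into
`MissingUpperBoundAt W 2` on the block (Miller currency + Cassels transport). WHAT IS NOT CLAIMED: the statement itself;
anything for irreducible `E[2]` (GEN 16's `KatoSharpAtTwoAdditiveNegOneSplitTwist`), CM, analytic rank `1`; lower bounds;
which curve `W_K` is. [cite: Kato2004Asterisque, Thm. 12.5 (3)(4) and (12.5.1) (p. 222), Thm. 12.6 (p. 222), Conj. 12.10 (p. 224), 13.13 (pp. 233–234), §14.14 and Lemma 14.15 (pp. 243–244), Prop. 14.16 (2) and its proof (pp. 244–245), §17.13 (p. 280)]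
[cite: GreenbergLNM1716, Thm. 1.14 (p. 68)] [cite: MazurTateTeitelbaum1986Invent, §I.17] [cite: MazurRubin2004, Thm. 2.3.4]
[cite: Lim2017FineSelmer, §3 Thm. 3.5] [cite: FerreroWashington1979, Theorem] -/
@[conjecture] def KatoMemberSharpAtTwoAdditiveNegOneSplitTwistReducible : Prop :=
  ∀ (W : WeierstrassCurve ℚ) [W.IsElliptic] [W.IsGloballyMinimal], ¬ W.HasCM →
    ¬ W.HasGoodReductionAtPrime 2 → ¬ W.HasMultiplicativeReductionAtPrime 2 →
    (W.quadraticTwist (-1)).HasSplitMultiplicativeReductionAtPrime 2 →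
    ¬ W.HasIrreducibleModPGaloisRep 2 →
    W.entireLFunction 1 ≠ 0 → Finite W.sha →
    ∃ (W' : WeierstrassCurve ℚ) (_ : W'.IsElliptic) (_ : W'.IsGloballyMinimal),
      IsIsogenous W W' ∧ Finite W'.sha ∧
      ∃ q : ℚ, W'.entireLFunction 1 / (W'.realPeriodRat : ℂ) = (q : ℂ) ∧
        (padicValNat 2 (Nat.card (AddCommGroup.primaryComponent W'.sha 2)) : ℤ) +
            padicValNat 2 W'.tamagawaProduct ≤
          padicValRat 2 q + 2 * (padicValNat 2 W'.torsionOrder : ℤ)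

/-- [crux, MEMO] **The MEMBER-SHARP Kato-at-`2` bound on the additive (−2)-split-twist block with REDUCIBLE `E[2]`** (9
X5@2 potentially multiplicative classes): as `KatoMemberSharpAtTwoAdditiveNegOneSplitTwistReducible` with the twist by `−2`
split multiplicative at `2` (then `W^{(−1)} = (W^{(−2)})^{(2)}` is additive: the two blocks are disjoint). CONTENT = R14 with
T20 (f): the same transport with `F = ℚ(√−2)`, the `χ_{−2}`-branch of the one-term measure of `W^{(−2)}`, `𝔮₀ = (T + 6/5)`,
`ι𝔮₀ = (T + 6)`; its object-level input (the twin of §1) is NOT typed because that branch has no tree name (vocabulary gap,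
T20 (f)). STATUS: conjecture-grade label unchanged until that twin is typed; mathematically on the same footing as the
(−1)-block. WHAT IS NOT CLAIMED: as above. [cite: Kato2004Asterisque, Thm. 12.5 (3)(4) and (12.5.1) (p. 222), Thm. 12.6 (p. 222), Conj. 12.10 (p. 224), 13.13 (pp. 233–234), Prop. 14.16 (2) and its proof (pp. 244–245), Thm. 16.6 (p. 271), §17.13 (p. 280)]
[cite: GreenbergLNM1716, Thm. 1.14 (p. 68)] [cite: MazurTateTeitelbaum1986Invent, §I.17] [cite: MazurRubin2004, Thm. 2.3.4]
[cite: Lim2017FineSelmer, §3 Thm. 3.5] [cite: FerreroWashington1979, Theorem] -/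
@[conjecture] def KatoMemberSharpAtTwoAdditiveNegTwoSplitTwistReducible : Prop :=
  ∀ (W : WeierstrassCurve ℚ) [W.IsElliptic] [W.IsGloballyMinimal], ¬ W.HasCM →
    ¬ W.HasGoodReductionAtPrime 2 → ¬ W.HasMultiplicativeReductionAtPrime 2 →
    (W.quadraticTwist (-2)).HasSplitMultiplicativeReductionAtPrime 2 →
    ¬ W.HasIrreducibleModPGaloisRep 2 →
    W.entireLFunction 1 ≠ 0 → Finite W.sha →
    ∃ (W' : WeierstrassCurve ℚ) (_ : W'.IsElliptic) (_ : W'.IsGloballyMinimal),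
      IsIsogenous W W' ∧ Finite W'.sha ∧
      ∃ q : ℚ, W'.entireLFunction 1 / (W'.realPeriodRat : ℂ) = (q : ℂ) ∧
        (padicValNat 2 (Nat.card (AddCommGroup.primaryComponent W'.sha 2)) : ℤ) +
            padicValNat 2 W'.tamagawaProduct ≤
          padicValRat 2 q + 2 * (padicValNat 2 W'.torsionOrder : ℤ)

/-! ## §3 Pure logic: the two blocks = the complement of (NST′) on the reducible additive curves -/

/-- **The member-sharp bound on EVERY reducible additive curve with a split multiplicative twist by `−1` or `−2`** (the
negation of the (NST′) hypothesis of `Kato2004.exists_memberHullInputs_two_sharp_of_noSplitTwistNegOneNegTwo`) from the two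
block targets — classical logic («not (no split twist by `−1` or `−2`)» = «`W^{(−1)}` split or `W^{(−2)}` split»).
[cite: Kato2004Asterisque, Thm. 12.5 (3) and (12.5.1) (p. 222), Conj. 12.10 (p. 224)] -/
theorem katoMemberSharpAtTwoAdditiveSplitTwistReducible_of_negOne_of_negTwo
    (hR₁ : KatoMemberSharpAtTwoAdditiveNegOneSplitTwistReducible)
    (hR₂ : KatoMemberSharpAtTwoAdditiveNegTwoSplitTwistReducible) :
    ∀ (W : WeierstrassCurve ℚ) [W.IsElliptic] [W.IsGloballyMinimal], ¬ W.HasCM →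
      ¬ W.HasGoodReductionAtPrime 2 → ¬ W.HasMultiplicativeReductionAtPrime 2 →
      ¬ (∀ d : ℚ, d = -1 ∨ d = -2 → ¬ (W.quadraticTwist d).HasSplitMultiplicativeReductionAtPrime 2) →
      ¬ W.HasIrreducibleModPGaloisRep 2 →
      W.entireLFunction 1 ≠ 0 → Finite W.sha →
      ∃ (W' : WeierstrassCurve ℚ) (_ : W'.IsElliptic) (_ : W'.IsGloballyMinimal),
        IsIsogenous W W' ∧ Finite W'.sha ∧
        ∃ q : ℚ, W'.entireLFunction 1 / (W'.realPeriodRat : ℂ) = (q : ℂ) ∧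
          (padicValNat 2 (Nat.card (AddCommGroup.primaryComponent W'.sha 2)) : ℤ) +
              padicValNat 2 W'.tamagawaProduct ≤
            padicValRat 2 q + 2 * (padicValNat 2 W'.torsionOrder : ℤ) := by
  intro W _ _ hcm hgood hmult hst hred hL hfin
  by_cases hneg : (W.quadraticTwist (-1)).HasSplitMultiplicativeReductionAtPrime 2
  · exact hR₁ W hcm hgood hmult hneg hred hL hfin
  · have hneg2 : (W.quadraticTwist (-2)).HasSplitMultiplicativeReductionAtPrime 2 := by
      by_contra h2
      exact hst (fun d hd => by
        rcases hd with rfl | rfl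
        · exact hneg
        · exact h2)
    exact hR₂ W hcm hgood hmult hneg2 hred hL hfin

/-- **Conversely the combined statement gives each block** (recorded so that either currency may be cited).
[cite: Kato2004Asterisque, Conj. 12.10 (p. 224)] -/
theorem katoMemberSharpAtTwoAdditiveNegOne_and_negTwo_of_splitTwistReducible
    (h : ∀ (W : WeierstrassCurve ℚ) [W.IsElliptic] [W.IsGloballyMinimal], ¬ W.HasCM →
      ¬ W.HasGoodReductionAtPrime 2 → ¬ W.HasMultiplicativeReductionAtPrime 2 →
      ¬ (∀ d : ℚ, d = -1 ∨ d = -2 → ¬ (W.quadraticTwist d).HasSplitMultiplicativeReductionAtPrime 2) →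
      ¬ W.HasIrreducibleModPGaloisRep 2 →
      W.entireLFunction 1 ≠ 0 → Finite W.sha →
      ∃ (W' : WeierstrassCurve ℚ) (_ : W'.IsElliptic) (_ : W'.IsGloballyMinimal),
        IsIsogenous W W' ∧ Finite W'.sha ∧
        ∃ q : ℚ, W'.entireLFunction 1 / (W'.realPeriodRat : ℂ) = (q : ℂ) ∧
          (padicValNat 2 (Nat.card (AddCommGroup.primaryComponent W'.sha 2)) : ℤ) +
              padicValNat 2 W'.tamagawaProduct ≤
            padicValRat 2 q + 2 * (padicValNat 2 W'.torsionOrder : ℤ)) :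
    KatoMemberSharpAtTwoAdditiveNegOneSplitTwistReducible ∧ KatoMemberSharpAtTwoAdditiveNegTwoSplitTwistReducible := by
  refine ⟨fun W _ _ hcm hgood hmult hsp hred hL hfin => h W hcm hgood hmult ?_ hred hL hfin,
    fun W _ _ hcm hgood hmult hsp hred hL hfin => h W hcm hgood hmult ?_ hred hL hfin⟩
  · exact fun h' => h' (-1) (Or.inl rfl) hsp
  · exact fun h' => h' (-2) (Or.inr rfl) hsp


/-! ## §4 (APPEND, same seat) R15 — the (−2)-block IS the (−1)-block read at the twist by `2`: no `χ_{−2}`-branch object is needed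

**R15 (the vocabulary gap of T20 (f) closed at reading level).** Let `W` be in a (−2)-block (`W^{(−2)} = E″` split
multiplicative at `2`). Then `W₂ := W^{(2)}` (any model) is in the corresponding (−1)-block: `(W^{(2)})^{(−1)} = W^{(−2)}` ON
THE NOSE (`quadraticTwist_quadraticTwist`; kernel `hasSplitMultiplicativeReductionAtPrime_twistNegOne_quadraticTwist_two_iff`),
and conversely `W ↦ W^{(2)}` maps a (−1)-block into the (−2)-block (`(W^{(2)})^{(−2)} = W^{(−4)} ≅ W^{(−1)}`, kernel
`…_twistNegTwo_quadraticTwist_two_iff`) and is an involution up to `ℚ`-isomorphism (`(W^{(2)})^{(2)} = W^{(4)} ≅ W`). The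
character `χ₂` of `ℚ(√2)` is the ORDER-2 CHARACTER OF `Γ` (`ℚ(√2) = ℚ₁ ⊂ ℚ_∞`; on `Gal(ℚ(ζ₈)/ℚ) = {±1} × ⟨5⟩`: `σ_{−1}(√2) = √2`,
`σ₅(√2) = −√2`), trivial on `G_{ℚ(ζ₈)}`, and `T₂W ≅ T₂W₂ ⊗ χ₂` as `G_ℚ`-modules. Twisting by a character of `G_∞ ⊃ Γ` commutes
with Kato's full-tower objects (`𝐇^i(T ⊗ χ) = 𝐇^i(T) ⊗ χ`, `𝐇²_loc` likewise, `X(W/ℚ_∞) = X(W₂/ℚ_∞) ⊗ χ₂` since `χ₂|_{G_{ℚ_∞}} = 1`;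
K. Rubin, *Euler Systems*, Ch. VI §1–§2 «twisting by characters of `Γ`»; for Kato: the Euler system lives over every `ℚ(ζ_m)`,
so the zeta elements of `f_W = f_{W₂} ⊗ χ₂` are the `χ₂`-twists of those of `f_{W₂}`) and acts on `Λ' = ℤ₂⟦T⟧` by the
AUTOMORPHISM `Tw_{χ₂} : γ ↦ χ₂(γ)γ`, i.e. `(1+T) ↦ −(1+T)`, `T ↦ −T − 2`, which carries `W₂`'s exceptional prime
`(T + 4/5)` to `−(T + 6/5)` and `(T − 4)` to `−(T + 6)` — EXACTLY T20 (f)'s `𝔮₀ = (T + 6/5)`, `ι𝔮₀ = (T + 6)` for `W`. Hence: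
**the (−2)-block targets (`KatoSharpAtTwoAdditiveNegTwoSplitTwist`, GEN 16; `KatoMemberSharpAtTwoAdditiveNegTwoSplitTwistReducible`,
§2) are READING-GRADE modulo the SAME object-level input as the (−1)-blocks — `KatoOddBranchInputsAtTwoNegOneSplitTwistAnyImage`
(§1) AT A GLOBALLY MINIMAL MODEL OF `W^{(2)}` — plus ONE standard reading (Γ-twist transport, Rubin VI): Conj. 12.10's
inequality at `𝔮₀(W)` for `T₂W` ⟺ Conj. 12.10's inequality at `𝔮₀(W₂)` for `T₂W₂` (lengths at corresponding height-one primes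
agree under `Tw_{χ₂}`), and the latter is T20 (a)–(e) for `W₂` (which is in the (−1)-block whatever its rank: §1 quantifies over
ALL globally minimal curves with `W^{(−1)}` split, and `X(W₂/ℚ_∞)` is torsion by the package itself, T20 (a)). The descent
T1–T14 / R1–R13 is then run for `W` itself at `T = 0` as before. So NO `χ_{−2}`-branch of the one-term measure is needed: in
T20 (f)'s notation `∫ χ_{−2}(x)(1+T)^{ℓ(x)} dμ⁻_{E″} = Tw_{χ₂}(L⁻_ω(E″)) = L⁻_ω(E″)(−T−2)` — the odd branch of §1 for `W₂`
(`(W₂)^{(−1)} = E″`) composed with `T ↦ −T − 2`. What is NOT claimed: a kernel derivation (the tree has no Γ-character twist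
transport for `IwasawaH1Data` / `SelmerDualData`); anything beyond the relabelling «(−2)-blocks: vocabulary gap» ↦
«(−2)-blocks: reading-grade modulo §1 at `W^{(2)}` + Rubin VI twist reading».
References: [Rubin2000] Ch. VI §1–§2 (twisting by characters of `Γ`); [Kato2004Asterisque] §13.9 (`σ_{−1}`), Thm. 12.5 with
(12.5.1) (p. 222); [SilvermanAEC2009] X.2 Prop. 2.4, X.5 Cor. 5.4 (twists compose modulo squares). -/

/-- **`(W^{(2)})^{(−1)} = W^{(−2)}` on the nose, read on the split-multiplicative predicate at `2`**: the twist by `−1` of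
`W^{(2)}` is split multiplicative at `2` iff `W^{(−2)}` is (R15: `W ↦ W^{(2)}` carries a (−2)-block into a (−1)-block).
Pure algebra of the tree's twist model (`quadraticTwist_quadraticTwist`: `(W^d)^{d'} = W^{d d'}`).
[cite: SilvermanAEC2009, X.2 Prop. 2.4 and X.5 Cor. 5.4] -/
theorem hasSplitMultiplicativeReductionAtPrime_twistNegOne_quadraticTwist_two_iff (W : WeierstrassCurve ℚ) :
    ((W.quadraticTwist 2).quadraticTwist (-1)).HasSplitMultiplicativeReductionAtPrime 2 ↔
      (W.quadraticTwist (-2)).HasSplitMultiplicativeReductionAtPrime 2 := by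
  rw [quadraticTwist_quadraticTwist]
  norm_num

/-- **`(W^{(2)})^{(−2)} = W^{(−4)} ≅_ℚ W^{(−1)}`, read on the split-multiplicative predicate at `2`**: the twist by `−2` of
`W^{(2)}` is split multiplicative at `2` iff `W^{(−1)}` is (R15: `W ↦ W^{(2)}` carries a (−1)-block into a (−2)-block). Uses
`(W^d)^{d'} = W^{dd'}`, `W^{d e²} = C • W^d` (`exists_variableChange_quadraticTwist_mul_sq`) and that split multiplicative
reduction at a prime is a property of the `ℚ`-isomorphism class (`hasSplitMultiplicativeReductionAtPrime_smul_iff`).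
[cite: SilvermanAEC2009, X.2 Prop. 2.4, X.5 Cor. 5.4 and VII.5 Prop. 5.1 (b)] -/
theorem hasSplitMultiplicativeReductionAtPrime_twistNegTwo_quadraticTwist_two_iff (W : WeierstrassCurve ℚ)
    [W.IsElliptic] :
    ((W.quadraticTwist 2).quadraticTwist (-2)).HasSplitMultiplicativeReductionAtPrime 2 ↔
      (W.quadraticTwist (-1)).HasSplitMultiplicativeReductionAtPrime 2 := by
  haveI : Fact (Nat.Prime 2) := ⟨Nat.prime_two⟩
  haveI : (W.quadraticTwist (-1)).IsElliptic := W.isElliptic_quadraticTwist (by norm_num)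
  obtain ⟨C, hC⟩ := W.exists_variableChange_quadraticTwist_mul_sq (-1) (2 : ℚ) two_ne_zero
  rw [quadraticTwist_quadraticTwist, show (2 : ℚ) * -2 = -1 * 2 ^ 2 by norm_num, ← hC,
    hasSplitMultiplicativeReductionAtPrime_smul_iff]

/-- **`W ↦ W^{(2)}` is an involution up to `ℚ`-isomorphism**: `(W^{(2)})^{(2)} = W^{(4)} = W^{(1·2²)} ≅ W^{(1)} ≅ W`
(`exists_variableChange_quadraticTwist_mul_sq`, `exists_variableChange_quadraticTwist_one`). With the two `iff`s above: the map
exchanges the (−1)- and (−2)-blocks (R15). [cite: SilvermanAEC2009, X.2 Prop. 2.4 and X.5 Cor. 5.4] -/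
theorem exists_variableChange_smul_eq_quadraticTwist_two_quadraticTwist_two (W : WeierstrassCurve ℚ) :
    ∃ C : VariableChange ℚ, C • W = (W.quadraticTwist 2).quadraticTwist 2 := by
  obtain ⟨C₁, hC₁⟩ := W.exists_variableChange_quadraticTwist_one
  obtain ⟨C₂, hC₂⟩ := W.exists_variableChange_quadraticTwist_mul_sq 1 (2 : ℚ) two_ne_zero
  refine ⟨C₂ * C₁, ?_⟩
  rw [mul_smul, hC₁, hC₂, quadraticTwist_quadraticTwist]
  norm_num


end Summit.BirchSwinnertonDyer.BirchSwinnertonDyer.Theorems.AddKatoTwo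

end
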